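import Mathlib.NumberTheory.ModularForms.QExpansion
import Mathlib.NumberTheory.ModularForms.Discriminant
import Summits.Langlands.Langlands.Theorems.CapacityClassicalityCongruenceToClassicalDefs

/-!
# q-series asymptotics at `i∞`

Helper file for `CongruenceToClassical` (route CapacityClassicality, item stmt-Langlands-10367):
limits at `i∞` of functions on `ℍ` given by convergent `q`-series, and the basic dichotomy for a
quotient `H = φ / Δ ^ m` of a function `φ` with a convergent `q_M`-expansion by a power of the
discriminant: if the coefficients of `φ` below `n₀` vanish then `H · q_M ^ (m M - n₀)` tends to the
`n₀`-th coefficient, so `H = O(exp(2π (mM - n₀) Im τ / M))`.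
-/

set_option linter.dupNamespace false -- project-wide option (lakefile weak.linter.dupNamespace); `Summit.Langlands.Langlands` is the mandated namespace

noncomputable section

open Complex Filter Asymptotics UpperHalfPlane Function

open scoped Real Topology

open Function.Periodic (qParam)

namespace Summit.Langlands.Langlands.Theorems.CapacityClassicality

/-! ## Limits of `q`-series -/

/-- Shifting a `q`-series whose first `n₀` coefficients vanish. -/
theorem hasSum_shift {c : ℕ → ℂ} {q s : ℂ} (hq : q ≠ 0) (n₀ : ℕ) (hc : ∀ n < n₀, c n = 0)
    (h : HasSum (fun n ↦ c n * q ^ n) s) :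
    HasSum (fun n ↦ c (n + n₀) * q ^ n) (s / q ^ n₀) := by
  rw [← hasSum_nat_add_iff' n₀] at h
  have hsum0 : ∑ i ∈ Finset.range n₀, c i * q ^ i = 0 :=
    Finset.sum_eq_zero fun i hi ↦ by simp [hc i (Finset.mem_range.mp hi)]
  rw [hsum0, sub_zero] at h
  have h2 := h.div_const (q ^ n₀)
  have h3 : (fun n ↦ c (n + n₀) * q ^ (n + n₀) / q ^ n₀) = fun n ↦ c (n + n₀) * q ^ n := by
    funext n
    rw [pow_add, ← mul_assoc, mul_div_cancel_right₀ _ (pow_ne_zero _ hq)]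
  rwa [h3] at h2

/-- A function on `ℍ` given by a convergent `q`-series tends to its constant coefficient at
`i∞`. -/
theorem tendsto_atImInfty_of_hasSum {h : ℝ} (hh : 0 < h) {f : ℍ → ℂ} {c : ℕ → ℂ}
    (hf : ∀ τ : ℍ, HasSum (fun n ↦ c n * qParam h τ ^ n) (f τ)) :
    Tendsto f atImInfty (𝓝 (c 0)) := by
  set g : ℍ → ℂ := fun τ ↦ (f τ - c 0 * qParam h τ ^ 0) / qParam h τ ^ 1 with hg_def
  have hg : ∀ τ : ℍ, HasSum (fun n ↦ c (n + 1) • qParam h τ ^ n) (g τ) := by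
    intro τ
    have h1 := hf τ
    rw [← hasSum_nat_add_iff' 1] at h1
    simp only [Finset.range_one, Finset.sum_singleton] at h1
    have h2 := h1.div_const (qParam h τ ^ 1)
    have h3 : (fun n ↦ c (n + 1) * qParam h τ ^ (n + 1) / qParam h τ ^ 1) =
        fun n ↦ c (n + 1) • qParam h τ ^ n := by
      funext n
      rw [smul_eq_mul, pow_add, ← mul_assoc,
        mul_div_cancel_right₀ _ (pow_ne_zero _ (Periodic.qParam_ne_zero _))]
    rwa [h3] at h2
  have hbdd : IsBoundedAtImInfty g := isBoundedAtImInfty_of_hasSum_qExpansion hh hg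
  have hq0 : Tendsto (fun τ : ℍ ↦ qParam h τ) atImInfty (𝓝 0) := qParam_tendsto_atImInfty hh
  have h0 : Tendsto (fun τ ↦ g τ * qParam h τ) atImInfty (𝓝 0) := by
    have hbdd' : g =O[atImInfty] (fun _ ↦ (1 : ℝ)) := hbdd
    have h3 : (fun τ ↦ g τ * qParam h τ) =O[atImInfty] (fun τ ↦ (1 : ℝ) * ‖qParam h τ‖) :=
      hbdd'.mul (isBigO_refl (fun τ : ℍ ↦ qParam h τ) atImInfty).norm_right
    refine h3.trans_tendsto ?_
    simpa using hq0.norm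
  have h4 : Tendsto (fun τ ↦ c 0 + g τ * qParam h τ) atImInfty (𝓝 (c 0 + 0)) := h0.const_add _
  rw [add_zero] at h4
  refine h4.congr fun τ ↦ ?_
  simp only [hg_def, pow_zero, mul_one, pow_one]
  field_simp [Periodic.qParam_ne_zero]
  ring

/-- A function on `ℍ` given by a convergent `q`-series is `O(1)` at `i∞`. -/
theorem isBigO_one_of_hasSum {h : ℝ} (hh : 0 < h) {f : ℍ → ℂ} {c : ℕ → ℂ}
    (hf : ∀ τ : ℍ, HasSum (fun n ↦ c n * qParam h τ ^ n) (f τ)) :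
    f =O[atImInfty] (fun _ ↦ (1 : ℝ)) :=
  isBoundedAtImInfty_of_hasSum_qExpansion hh (fun τ ↦ by simpa using hf τ)

/-! ## The discriminant -/

/-- The unit part `Δ / q = ∏ (1 - qⁿ)²⁴` of the discriminant does not vanish. -/
lemma tprod_one_sub_eta_q_ne_zero (τ : ℍ) : ∏' n, (1 - ModularForm.eta_q n τ) ^ 24 ≠ 0 := by
  intro h
  apply ModularForm.discriminant_ne_zero τ
  rw [ModularForm.discriminant_eq_q_prod, h, mul_zero]

/-- `q = q_M ^ M`. -/
lemma qParam_one_eq_pow (M : ℕ) (hM : 0 < M) (τ : ℍ) : qParam 1 (τ : ℂ) = qParam M τ ^ M := by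
  rw [qParam, qParam, ← Complex.exp_nat_mul]
  congr 1
  have : (M : ℂ) ≠ 0 := by exact_mod_cast hM.ne'
  push_cast
  field_simp

/-! ## The dichotomy for `φ / Δ ^ m` -/

/-- If `H · Δ ^ m` has a convergent `q_M`-expansion whose coefficients below `n₀ ≤ m M` vanish,
then `H · q_M ^ (m M - n₀)` tends to the `n₀`-th coefficient at `i∞`. -/
theorem tendsto_mul_qParam_pow_of_hasSum {M : ℕ} (hM : 0 < M) {m n₀ : ℕ} (hn₀ : n₀ ≤ m * M)
    {H : ℍ → ℂ} {c : ℕ → ℂ} (hc : ∀ n < n₀, c n = 0)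
    (hH : ∀ τ : ℍ, HasSum (fun n ↦ c n * qParam M τ ^ n) (H τ * ModularForm.discriminant τ ^ m)) :
    Tendsto (fun τ ↦ H τ * qParam M τ ^ (m * M - n₀)) atImInfty (𝓝 (c n₀)) := by
  have hMr : (0 : ℝ) < M := by exact_mod_cast hM
  have hψ : ∀ τ : ℍ, HasSum (fun n ↦ c (n + n₀) * qParam M τ ^ n)
      (H τ * ModularForm.discriminant τ ^ m / qParam M τ ^ n₀) :=
    fun τ ↦ hasSum_shift (Periodic.qParam_ne_zero _) n₀ hc (hH τ)
  have h1 : Tendsto (fun τ : ℍ ↦ H τ * ModularForm.discriminant τ ^ m / qParam M τ ^ n₀) atImInfty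
      (𝓝 (c n₀)) := by
    simpa using tendsto_atImInfty_of_hasSum hMr hψ
  have h2 : Tendsto (fun τ : ℍ ↦ (∏' n, (1 - ModularForm.eta_q n τ) ^ 24) ^ m) atImInfty
      (𝓝 1) := by
    simpa using ModularForm.tendsto_atImInfty_tprod_one_sub_eta_q_pow.pow m
  have h3 := h1.div h2 one_ne_zero
  rw [div_one] at h3
  refine h3.congr fun τ ↦ ?_
  simp only [Pi.div_apply]
  have hq : qParam (M : ℝ) (τ : ℂ) ≠ 0 := Periodic.qParam_ne_zero _
  have hu := tprod_one_sub_eta_q_ne_zero τ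
  rw [ModularForm.discriminant_eq_q_prod, qParam_one_eq_pow M hM τ, mul_pow, ← pow_mul]
  obtain ⟨d, hd⟩ := Nat.exists_eq_add_of_le hn₀
  rw [hd, Nat.add_sub_cancel_left, show M * m = n₀ + d by rw [mul_comm, hd], pow_add]
  field_simp

/-- If `H · Δ ^ m` has a convergent `q_M`-expansion whose coefficients below `n₁ ≤ m M` vanish,
then `H = O (Egr ((m M - n₁) / M))` at `i∞`. -/
theorem isBigO_Egr_of_hasSum {M : ℕ} (hM : 0 < M) {m n₁ : ℕ} (hn₁ : n₁ ≤ m * M)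
    {H : ℍ → ℂ} {c : ℕ → ℂ} (hc : ∀ n < n₁, c n = 0)
    (hH : ∀ τ : ℍ, HasSum (fun n ↦ c n * qParam M τ ^ n) (H τ * ModularForm.discriminant τ ^ m)) :
    H =O[atImInfty] Egr (((m * M - n₁ : ℕ) : ℝ) / M) := by
  have h1 := tendsto_mul_qParam_pow_of_hasSum hM hn₁ hc hH
  have h2 : (fun τ ↦ H τ * qParam M τ ^ (m * M - n₁)) =O[atImInfty] (fun _ ↦ (1 : ℝ)) :=
    h1.isBigO_one ℝ
  have h3 : H = fun τ ↦ (H τ * qParam M τ ^ (m * M - n₁)) * (qParam M τ ^ (m * M - n₁))⁻¹ := by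
    funext τ
    rw [mul_inv_cancel_right₀ (pow_ne_zero _ (Periodic.qParam_ne_zero _))]
  rw [h3]
  refine (h2.mul (isBigO_refl (fun τ : ℍ ↦ (qParam (M : ℝ) (τ : ℂ) ^ (m * M - n₁))⁻¹)
    atImInfty).norm_right).trans ?_
  refine (isBigO_of_le _ fun τ ↦ ?_)
  rw [one_mul, norm_norm, norm_inv, norm_qParam_pow_eq_Egr, norm_Egr, Egr, Egr, ← Real.exp_neg]
  apply le_of_eq
  congr 1
  ring

end Summit.Langlands.Langlands.Theorems.CapacityClassicality
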